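import Summits.KontsevichZagierPeriods.KontsevichZagierPeriods.Theorems.TerasomaMultiplicationBetaCancellationOfPiCancellation
import Summits.KontsevichZagierPeriods.KontsevichZagierPeriods.Theorems.BetaCancellation.Negative.PrimitiveCriterion
import Literature.NumberTheory.Transcendental.KZMellinFibres

/-!
# `BetaCancellation` (stmt-KontsevichZagierPeriods-13633) — ONE INTEGER EXPONENT SUFFICES (unconditional sector)

Scratch header (lead c13): registered stub `betaCancellation_of_int_or_int`, to be proved by a stub-worker.

Line `dirichlet-companion-to-pi`, unconditional sector: if ONE of the exponents `a, b` is a positive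
integer (the other any positive rational), `KernelCancellation (β(a,b))` — hence the crux in its
literal shape — HOLDS. (1) `β(a,1) = t^{a-1}` on `(0,1)` has the `ℚ`-semialgebraic primitive
`t^a / a` on `[0,1]` with `K 1 − K 0 = 1/a ≠ 0`, so the PRIMITIVE CRITERION
(`BetaCancellationNegative.kernelCancellation_of_primitive`) gives `KernelCancellation (β(a,1))` for
EVERY rational `a > 0`; (2) the swap `kernelCancellation_betaKernel_symm` gives `β(1,b)`; (3) the
landed translation `kernelCancellation_betaKernel_succ` climbs to `β(a,B+1)`, `β(A+1,b)`.
-/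

noncomputable section

set_option linter.dupNamespace false

namespace Summit.KontsevichZagierPeriods.KontsevichZagierPeriods.BetaCancellationLine

open MeasureTheory Set
open Literature.NumberTheory.Transcendental
open Literature.NumberTheory.Transcendental.KZ
open Summit.KontsevichZagierPeriods.KontsevichZagierPeriods.BetaCancellationNegative
open Literature.ModelTheory.ExponentialFields (IsSemialgebraic)
open Literature.NumberTheory.Transcendental.KZreg (unitIoo isSemialgebraic_unitIoo)

/-! ## Extension to the closed interval, and Euler–Mellin monomials on `(0,1)` -/

/-- **Extension by rational endpoint values**: a function on `ℝ¹` which is `ℚ`-semialgebraic on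
`(0,1)` and takes rational values `c₀`, `c₁` at `x 0 = 0`, `x 0 = 1` is `ℚ`-semialgebraic on
`[0,1]` (the graph gains two rational points). [folklore] -/
theorem isSemialgebraicFunOn_unitIcc_of_unitIoo {f : (Fin 1 → ℝ) → ℝ}
    (hf : IsSemialgebraicFunOn ℚ unitIoo f) (c₀ c₁ : ℚ)
    (h0 : ∀ x : Fin 1 → ℝ, x 0 = 0 → f x = c₀) (h1 : ∀ x : Fin 1 → ℝ, x 0 = 1 → f x = c₁) :
    IsSemialgebraicFunOn ℚ unitIcc f := by
  -- adapted from Cruxes/BetaCancellation/Disproof.lean §13 (`isSemialgebraicFunOn_unitIcc_of_unitIoo`)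
  rw [isSemialgebraicFunOn_iff] at hf ⊢
  have hpt : ∀ (u c : ℚ), IsSemialgebraic ℚ
      {z : Fin (1 + 1) → ℝ | (Fin.init z : Fin 1 → ℝ) 0 = (u : ℝ) ∧ z (Fin.last 1) = (c : ℝ)} := by
    intro u c
    have h1 := Literature.ModelTheory.ExponentialFields.isSemialgebraic_setOf_eval_eq_zero
      (k := ℚ) (R := ℝ) (MvPolynomial.X (Fin.castSucc (0 : Fin 1)) - MvPolynomial.C u :
        MvPolynomial (Fin (1 + 1)) ℚ)
    have h2 := Literature.ModelTheory.ExponentialFields.isSemialgebraic_setOf_eval_eq_zero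
      (k := ℚ) (R := ℝ) (MvPolynomial.X (Fin.last 1) - MvPolynomial.C c : MvPolynomial (Fin (1 + 1)) ℚ)
    convert h1.inter h2 using 1
    ext z
    simp only [mem_setOf_eq, mem_inter_iff, map_sub, MvPolynomial.aeval_X, MvPolynomial.aeval_C,
      eq_ratCast, sub_eq_zero, Fin.init]
  have hset : {z : Fin (1 + 1) → ℝ | (Fin.init z : Fin 1 → ℝ) ∈ unitIcc ∧ z (Fin.last 1) = f (Fin.init z)} =
      {z | (Fin.init z : Fin 1 → ℝ) ∈ unitIoo ∧ z (Fin.last 1) = f (Fin.init z)} ∪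
      {z | (Fin.init z : Fin 1 → ℝ) 0 = ((0:ℚ):ℝ) ∧ z (Fin.last 1) = (c₀:ℝ)} ∪
      {z | (Fin.init z : Fin 1 → ℝ) 0 = ((1:ℚ):ℝ) ∧ z (Fin.last 1) = (c₁:ℝ)} := by
    ext z
    simp only [mem_union, mem_setOf_eq, mem_unitIcc, mem_Icc, mem_unitIoo, mem_Ioo, Rat.cast_zero,
      Rat.cast_one]
    constructor
    · rintro ⟨⟨hl, hr⟩, hz⟩
      rcases hl.lt_or_eq with hl | hl
      · rcases hr.lt_or_eq with hr | hr
        · exact Or.inl (Or.inl ⟨⟨hl, hr⟩, hz⟩)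
        · exact Or.inr ⟨hr, by rw [hz, h1 _ hr]⟩
      · exact Or.inl (Or.inr ⟨hl.symm, by rw [hz, h0 _ hl.symm]⟩)
    · rintro ((⟨⟨hl, hr⟩, hz⟩ | ⟨hl, hz⟩) | ⟨hl, hz⟩)
      · exact ⟨⟨hl.le, hr.le⟩, hz⟩
      · exact ⟨⟨hl.ge, by rw [hl]; exact zero_le_one⟩, by rw [hz, h0 _ hl]⟩
      · exact ⟨⟨by rw [hl]; exact zero_le_one, hl.le⟩, by rw [hz, h1 _ hl]⟩
  rw [hset]
  exact (hf.union (hpt 0 c₀)).union (hpt 1 c₁)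

/-- **Euler–Mellin monomials are `ℚ`-semialgebraic on `(0,1)`**: `x ↦ c · (x 0)^e` for rational
`c, e` (`KZ.isSemialgebraicFunOn_mellinIntegrand`). [folklore] -/
theorem isSemialgebraicFunOn_const_mul_rpow_unitIoo (c e : ℚ) :
    IsSemialgebraicFunOn ℚ unitIoo (fun x => (c : ℝ) * (x 0) ^ ((e : ℚ) : ℝ)) := by
  -- adapted from Cruxes/BetaCancellation/Disproof.lean §13 (`isSemialgebraicFunOn_const_mul_rpow_unitIoo`)
  refine (isSemialgebraicFunOn_mellinIntegrand isSemialgebraic_unitIoo ![MvPolynomial.X 0] ![e] c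
    (fun x hx k => ?_)).congr fun x _ => ?_
  · have hk : k = 0 := Fin.fin_one_eq_zero k
    subst hk
    simpa using hx.1
  · simp [mellinIntegrand_apply]

/-! ## `β(a,1)` for every rational `a > 0`: the primitive criterion with `K = t^a / a` -/

/-- `β(a,1) = t^{a-1}` (extended by `0`) on `(0,1)`. [folklore] -/
theorem betaKernel_one_eqOn_rpow_ite (a : ℚ) :
    EqOn (betaKernel a 1) (fun t : ℝ => if t ∈ Set.Ioo (0:ℝ) 1 then t ^ ((a:ℝ) - 1) else 0)
      (Ioo 0 1) := by
  intro t ht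
  simp only [if_pos ht, betaKernel, Rat.cast_one, sub_self, Real.rpow_zero, mul_one]

/-- The kernel `t^{a-1}` on `(0,1)`, extended by `0`, is `ℚ`-semialgebraic on `[0,1]`. [folklore] -/
theorem isSemialgebraicFunOn_rpow_ite_unitIcc (a : ℚ) :
    IsSemialgebraicFunOn ℚ unitIcc
      (fun x : Fin 1 → ℝ => if x 0 ∈ Set.Ioo (0:ℝ) 1 then (x 0) ^ ((a:ℝ) - 1) else 0) := by
  -- adapted from Cruxes/BetaCancellation/Disproof.lean §13 (`isSemialgebraicFunOn_powKernel`)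
  refine isSemialgebraicFunOn_unitIcc_of_unitIoo ?_ 0 0 (fun x hx => ?_) (fun x hx => ?_)
  · refine (isSemialgebraicFunOn_const_mul_rpow_unitIoo 1 (a - 1)).congr fun x hx => ?_
    have hx' : x 0 ∈ Ioo (0:ℝ) 1 := hx
    simp only [if_pos hx', Rat.cast_one, one_mul, Rat.cast_sub]
  · have : x 0 ∉ Ioo (0:ℝ) 1 := fun h => by rw [hx] at h; exact lt_irrefl _ h.1
    simp only [if_neg this, Rat.cast_zero]
  · have : x 0 ∉ Ioo (0:ℝ) 1 := fun h => by rw [hx] at h; exact lt_irrefl _ h.2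
    simp only [if_neg this, Rat.cast_zero]

/-- The kernel `t^{a-1}` on `(0,1)`, extended by `0`, is integrable on `[0,1]` for `a > 0`.
[folklore] -/
theorem integrableOn_rpow_ite_Icc {a : ℚ} (ha : 0 < a) :
    IntegrableOn (fun t : ℝ => if t ∈ Set.Ioo (0:ℝ) 1 then t ^ ((a:ℝ) - 1) else 0) (Icc (0:ℝ) 1) := by
  rw [integrableOn_Icc_iff_integrableOn_Ioo]
  exact ((integrableOn_betaKernel_and_integral_eq ha one_pos).1).congr_fun
    (betaKernel_one_eqOn_rpow_ite a) measurableSet_Ioo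

/-- The primitive `t^a / a` is `ℚ`-semialgebraic on `[0,1]` for `a > 0`. [folklore] -/
theorem isSemialgebraicFunOn_rpow_div_unitIcc {a : ℚ} (ha : 0 < a) :
    IsSemialgebraicFunOn ℚ unitIcc (fun x : Fin 1 → ℝ => (x 0) ^ (a:ℝ) / a) := by
  -- adapted from Cruxes/BetaCancellation/Disproof.lean §13 (`isSemialgebraicFunOn_powPrim`)
  have ha' : (a:ℝ) ≠ 0 := by exact_mod_cast ha.ne'
  refine isSemialgebraicFunOn_unitIcc_of_unitIoo ?_ 0 a⁻¹ (fun x hx => ?_) (fun x hx => ?_)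
  · refine (isSemialgebraicFunOn_const_mul_rpow_unitIoo a⁻¹ a).congr fun x _ => ?_
    simp only [Rat.cast_inv]
    rw [div_eq_inv_mul]
  · simp only [hx, Real.zero_rpow ha', zero_div, Rat.cast_zero]
  · simp only [hx, Real.one_rpow, one_div, Rat.cast_inv]

/-- The primitive `t^a / a` is continuous on `[0,1]` for `a > 0`. [folklore] -/
theorem continuousOn_rpow_div_Icc {a : ℚ} (ha : 0 < a) :
    ContinuousOn (fun t : ℝ => t ^ (a:ℝ) / a) (Icc (0:ℝ) 1) := by
  have ha0 : (0:ℝ) ≤ a := by exact_mod_cast ha.le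
  exact (continuousOn_id.rpow_const fun x _ => Or.inr ha0).div_const _

/-- `(t^a / a)' = t^{a-1}` on `(0,1)`. [folklore] -/
theorem hasDerivAt_rpow_div {a : ℚ} (ha : 0 < a) {t : ℝ} (ht : t ∈ Ioo (0:ℝ) 1) :
    HasDerivAt (fun t : ℝ => t ^ (a:ℝ) / a)
      (if t ∈ Set.Ioo (0:ℝ) 1 then t ^ ((a:ℝ) - 1) else 0) t := by
  have ha' : (a:ℝ) ≠ 0 := by exact_mod_cast ha.ne'
  rw [if_pos ht]
  have h := (Real.hasDerivAt_rpow_const (x := t) (p := (a:ℝ)) (Or.inl ht.1.ne')).div_const (a:ℝ)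
  rw [mul_div_cancel_left₀ _ ha'] at h
  exact h

/-- `1^a / a − 0^a / a = 1/a`. [folklore] -/
theorem one_rpow_div_sub_zero_rpow_div {a : ℚ} (ha : 0 < a) :
    (1:ℝ) ^ (a:ℝ) / a - (0:ℝ) ^ (a:ℝ) / a = ((a⁻¹ : ℚ) : ℝ) := by
  have ha' : (a:ℝ) ≠ 0 := by exact_mod_cast ha.ne'
  simp only [Real.one_rpow, Real.zero_rpow ha', zero_div, sub_zero, one_div, Rat.cast_inv]

/-- `1^a / a − 0^a / a` is algebraic. [folklore] -/
theorem isAlgebraic_one_rpow_div_sub {a : ℚ} (ha : 0 < a) :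
    IsAlgebraic ℚ ((1:ℝ) ^ (a:ℝ) / a - (0:ℝ) ^ (a:ℝ) / a) := by
  rw [one_rpow_div_sub_zero_rpow_div ha]
  exact isAlgebraic_algebraMap (a⁻¹ : ℚ)

/-- `1^a / a − 0^a / a ≠ 0`. [folklore] -/
theorem one_rpow_div_sub_ne_zero {a : ℚ} (ha : 0 < a) :
    (1:ℝ) ^ (a:ℝ) / a - (0:ℝ) ^ (a:ℝ) / a ≠ 0 := by
  rw [one_rpow_div_sub_zero_rpow_div ha]
  exact_mod_cast (inv_ne_zero ha.ne')

/-- `KernelCancellation` for the kernel `t^{a-1}` (extended by `0`), every rational `a > 0`: the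
primitive criterion with `K = t^a / a`, `K 1 − K 0 = 1/a ≠ 0`. [folklore] -/
theorem kernelCancellation_rpow_ite {a : ℚ} (ha : 0 < a) :
    KernelCancellation (fun t : ℝ => if t ∈ Set.Ioo (0:ℝ) 1 then t ^ ((a:ℝ) - 1) else 0) :=
  kernelCancellation_of_primitive
    (k := fun t : ℝ => if t ∈ Set.Ioo (0:ℝ) 1 then t ^ ((a:ℝ) - 1) else 0)
    (K := fun t : ℝ => t ^ (a:ℝ) / a)
    (isSemialgebraicFunOn_rpow_ite_unitIcc a) (integrableOn_rpow_ite_Icc ha)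
    (isSemialgebraicFunOn_rpow_div_unitIcc ha) (continuousOn_rpow_div_Icc ha)
    (fun _ ht => hasDerivAt_rpow_div ha ht) (isAlgebraic_one_rpow_div_sub ha)
    (one_rpow_div_sub_ne_zero ha)

/-- **`BetaCancellation` HOLDS at `(a, 1)` for EVERY rational `a > 0`** — including non-integer
`a`: the kernel `t^{a-1}` has the `ℚ`-semialgebraic primitive `t^a / a`, `K 1 − K 0 = 1/a ≠ 0`.
[folklore] -/
theorem kernelCancellation_betaKernel_rat_one {a : ℚ} (ha : 0 < a) :
    KernelCancellation (betaKernel a 1) :=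
  (kernelCancellation_congr (betaKernel_one_eqOn_rpow_ite a)).2 (kernelCancellation_rpow_ite ha)

/-- **`BetaCancellation` HOLDS at `(1, b)` for EVERY rational `b > 0`** (symmetry). [folklore] -/
theorem kernelCancellation_betaKernel_one_rat {b : ℚ} (hb : 0 < b) :
    KernelCancellation (betaKernel 1 b) :=
  kernelCancellation_betaKernel_symm one_pos hb (kernelCancellation_betaKernel_rat_one hb)

/-! ## `β(a, B+1)` and `β(A+1, b)` by translation -/

/-- **`BetaCancellation` HOLDS at `(a, B+1)`** for every rational `a > 0` and `B ∈ ℕ`. [folklore] -/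
theorem kernelCancellation_betaKernel_rat_natSucc {a : ℚ} (ha : 0 < a) (B : ℕ) :
    KernelCancellation (betaKernel a ((B:ℚ) + 1)) := by
  -- adapted from Cruxes/BetaCancellation/Disproof.lean §14 (`kernelCancellation_betaKernel_nat_right`)
  induction B with
  | zero => simpa using kernelCancellation_betaKernel_rat_one ha
  | succ B ih =>
    have h := kernelCancellation_betaKernel_succ ha (by positivity) ih
    push_cast at h ⊢
    exact h

/-- **`BetaCancellation` HOLDS at `(A+1, b)`** for every rational `b > 0` and `A ∈ ℕ`. [folklore] -/
theorem kernelCancellation_betaKernel_natSucc_rat {b : ℚ} (hb : 0 < b) (A : ℕ) :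
    KernelCancellation (betaKernel ((A:ℚ) + 1) b) :=
  kernelCancellation_betaKernel_symm (by positivity) hb (kernelCancellation_betaKernel_rat_natSucc hb A)

/-- **ONE INTEGER EXPONENT SUFFICES**: if `a` or `b` is a positive integer (the other any positive
rational), `KernelCancellation (β(a,b))` holds. [folklore] -/
theorem kernelCancellation_betaKernel_of_int_or_int {a b : ℚ} (ha : 0 < a) (hb : 0 < b)
    (h : (∃ A : ℕ, a = A + 1) ∨ (∃ B : ℕ, b = B + 1)) : KernelCancellation (betaKernel a b) := by
  rcases h with ⟨A, rfl⟩ | ⟨B, rfl⟩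
  · exact kernelCancellation_betaKernel_natSucc_rat hb A
  · exact kernelCancellation_betaKernel_rat_natSucc ha B

/-- **STUB `betaCancellation_of_int_or_int`**: `BetaCancellation` restricted to parameters ONE of which is a
positive integer (the other any positive rational) — in the crux's literal shape. [folklore] -/
theorem betaCancellation_of_int_or_int :
    ∀ (a b : ℚ), 0 < a → 0 < b → ((∃ A : ℕ, a = A + 1) ∨ (∃ B : ℕ, b = B + 1)) →
    ∀ ⦃n m : ℕ⦄ (r : IntegralRep n) (r' : IntegralRep m) (q : IntegralRep (1 + n)) (q' : IntegralRep (1 + m)),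
    q.domain = {z | z (Fin.castAdd n 0) ∈ Set.Ioo (0:ℝ) 1 ∧ (fun j => z (Fin.natAdd 1 j)) ∈ r.domain} →
    Set.EqOn q.integrand (fun z => (z (Fin.castAdd n 0)) ^ ((a:ℝ) - 1) * (1 - z (Fin.castAdd n 0)) ^ ((b:ℝ) - 1) *
      r.integrand (fun j => z (Fin.natAdd 1 j))) q.domain →
    q'.domain = {z | z (Fin.castAdd m 0) ∈ Set.Ioo (0:ℝ) 1 ∧ (fun j => z (Fin.natAdd 1 j)) ∈ r'.domain} →
    Set.EqOn q'.integrand (fun z => (z (Fin.castAdd m 0)) ^ ((a:ℝ) - 1) * (1 - z (Fin.castAdd m 0)) ^ ((b:ℝ) - 1) *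
      r'.integrand (fun j => z (Fin.natAdd 1 j))) q'.domain →
    Equivalent q q' → Equivalent r r' :=
  fun _ _ ha hb h _ _ r r' q q' hd hi hd' hi' hqq' =>
    kernelCancellation_betaKernel_of_int_or_int ha hb h r r' q q' ⟨hd, hi⟩ ⟨hd', hi'⟩ hqq'

end Summit.KontsevichZagierPeriods.KontsevichZagierPeriods.BetaCancellationLine
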